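import Mathlib
import Literature.AlgebraicGeometry.Ramification.InertiaNormalSylow
import Literature.AlgebraicGeometry.Ramification.NormalSylowExtensions
import Literature.RingTheory.CompleteLocalRings.TameAutomorphismCotangent
import Summits.ResolutionOfSingularities.ResolutionOfSingularities.Theorems.WildQuotientsWildQuotientResolutionStubBorelCore
import Summits.ResolutionOfSingularities.ResolutionOfSingularities.Theorems.WildQuotientsWildQuotientResolutionUnipotentLevel
import Summits.ResolutionOfSingularities.ResolutionOfSingularities.Theorems.WildQuotientsWildQuotientResolutionFlagPieces
import HarnessLib

/-!
# One equivariant blow-up step of Phase 0 in ARBITRARY embedding dimension (crux `WildQuotients.WildQuotientResolution`)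

Crux stmt-ResolutionOfSingularities-15640 (`WildQuotientResolution`), line `Sketch` (card
`p-closure-sylow-separation`), registered stub `stub_phaseZeroHighDim` (= PhaseZeroModel for
`dim X′ ≥ 3`). The local algebra of ONE equivariant blow-up of a `τ`-stable centre `J` through a
point `z` (local ring `(R, 𝔪, κ)` downstairs, `(S, 𝔫, κ₁)` at a point `x` upstairs over `z`,
`J S = ι(t) S` invertible upstairs, inertia `I = I_x ≤ I_z` acting on `R` faithfully and on `S`
residue-trivially): writing `ι r = e_r · ι t` for `r ∈ J`, the inertia stabilises the flag
`𝔪² ⊆ W̃ + 𝔪² ⊆ J + 𝔪² ⊆ 𝔪` of `V = 𝔪/𝔪²`, `W̃ = {r ∈ J | e_r ∈ 𝔫} = J ∩ ι⁻¹(𝔫 · ι t)`, and acts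
on the middle piece `J̄/W̄` through the character `χ g = e_{τ g t} mod 𝔫 ∈ κ₁ˣ`. The landed
`BorelCore.stub_borelCore` (`J = 𝔪`, `dim V ≤ 2`) and `FlagCore.stub_flagCore` (`dim J̄ ≤ 2`,
`codim J̄ ≤ 1`: embedding dimension `3`) are the cases in which the outer pieces `W̄`, `V/J̄` are
LINES. This file proves the step with NO dimension bound, the outer pieces being governed by
hypotheses — the shape an induction on the embedding dimension (Phase 0 on `4`-folds and up)
consumes:

**Theorem** (`hasNormalSylow_of_blowupStep`). In the situation above, suppose the action of `I`
on `W̄` factors through a finite p-closed group `A₀` (a homomorphism `f₀ : I → A₀` whose kernel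
moves every `r ∈ J` with `ι r ∈ 𝔫 · ι t` only inside `𝔪²`) and the action on `V/J̄` through a
finite p-closed group `A₂` (`f₂ : I → A₂` whose kernel moves `𝔪` inside `J + 𝔪²`). Then `I` has a
normal Sylow `p`-subgroup.

Proof. `χ` is constructed as in FlagCore ((2): `e_r`, `c g = e_{τ g t}`, a unit, multiplicative
modulo `𝔫`); `ker χ` moves `J` into `W̃` ((3) of FlagCore). So `U = ker (f₀, χ|, f₂)` — `χ|` the
corestriction of `χ` to its finite (abelian, hence p-closed) image — lowers the flag
`K = (𝔪², W̃ + 𝔪², J + 𝔪², 𝔪)` one step (`UnipotentLevel.iterate_sub_mem_of_flag`), is unipotent of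
level `3 ≤ p²`, so `g ^ (p ^ 2)` is cotangent-trivial (`UnipotentLevel.cotangentTrivial_pow_of_iterate_sub`);
the target `A₀ × χ(I) × A₂` is p-closed (`HasNormalSylow.prod`), and
`FlagPieces.hasNormalSylow_of_pClosed_quotient` concludes. No hypothesis `J ∩ 𝔪² ⊆ 𝔪J`,
`J ≤ 𝔪` or on generators of `J̄` is needed for THIS direction (they only serve to identify the
pieces geometrically). If `t = 0` then `J = 0` and `ker f₂` is already cotangent-trivial.

[OURS · crux stmt-ResolutionOfSingularities-15640 · helper toward `stub_phaseZeroHighDim`; folklore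
local algebra, counted 0; AI-level work, weaker than expert review.]

* `hasNormalSylow_range_of_comm` — the image of a homomorphism from a finite group to a
  commutative group is a finite p-closed group.
* `hasNormalSylow_of_blowupStep` — the theorem.
-/

-- single-problem summit: the doubled namespace component `ResolutionOfSingularities` is forced
set_option linter.dupNamespace false

open IsLocalRing Literature.AlgebraicGeometry.Ramification Literature.RingTheory.CompleteLocalRings
open Summit.ResolutionOfSingularities.ResolutionOfSingularities.Theorems.WildQuotientResolution.BorelCore
open Summit.ResolutionOfSingularities.ResolutionOfSingularities.Theorems.WildQuotientResolution.UnipotentLevel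
open Summit.ResolutionOfSingularities.ResolutionOfSingularities.Theorems.WildQuotientResolution.FlagPieces

namespace Summit.ResolutionOfSingularities.ResolutionOfSingularities.Theorems.WildQuotientResolution.FlagStep

/-- The image of a homomorphism from a finite group to a commutative group (e.g. a character
`I → κˣ`) is finite and p-closed: every subgroup of a commutative group is normal, in particular
its Sylow `p`-subgroup. [folklore] -/
theorem hasNormalSylow_range_of_comm {p : ℕ} {I C : Type*} [Group I] [Finite I] [CommGroup C]
    (χ : I →* C) : HasNormalSylow p χ.range :=
  ⟨Classical.arbitrary _, inferInstance⟩

/-- **One blow-up step of Phase 0, any embedding dimension** (crux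
stmt-ResolutionOfSingularities-15640, toward `stub_phaseZeroHighDim`). Let `(R, 𝔪, κ)` be a
Noetherian local ring and `(S, 𝔫, κ₁)` a local domain, both residue fields of characteristic `p`;
`ι : R → S` an injective local homomorphism; `J` an ideal with `J S = ι(t) S` for some `t ∈ J`;
`I` a finite group acting on `R` faithfully by `τ`, preserving `J`, and on `S` by `τ₁`, compatibly
(`ι ∘ τ g = τ₁ g ∘ ι`) and residue-trivially on `S`. Suppose the action of `I` on
`W̄ = (J ∩ ι⁻¹(𝔫 · ι t)) mod 𝔪²` factors through a finite p-closed group `A₀` (`f₀ : I →* A₀`, its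
kernel moving each `r ∈ J` with `ι r ∈ 𝔫 · ι t` inside `𝔪²`) and the action on `𝔪/(J + 𝔪²)`
through a finite p-closed group `A₂` (`f₂ : I →* A₂`, its kernel moving `𝔪` inside `J + 𝔪²`). Then
`I` has a normal Sylow `p`-subgroup. `FlagCore.stub_flagCore` is the case where both outer pieces
are lines (`A₀`, `A₂` images of characters), `BorelCore.stub_borelCore` the case `J = 𝔪`,
`dim 𝔪/𝔪² ≤ 2`. [folklore] -/
theorem hasNormalSylow_of_blowupStep (p : ℕ) [Fact p.Prime]
    {R S : Type*} [CommRing R] [IsLocalRing R] [IsNoetherianRing R]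
    [CommRing S] [IsLocalRing S] [IsDomain S]
    [CharP (ResidueField R) p] [CharP (ResidueField S) p]
    (ι : R →+* S) [IsLocalHom ι] (hι : Function.Injective ι)
    (J : Ideal R) (t : R) (ht : t ∈ J) (hgen : Ideal.map ι J = Ideal.span {ι t})
    {I : Type*} [Group I] [Finite I] (τ : I →* (R ≃+* R)) (τ₁ : I →* (S ≃+* S))
    (hτ : Function.Injective τ) (hJτ : ∀ (g : I), ∀ j ∈ J, τ g j ∈ J)
    (hcomp : ∀ (g : I) (r : R), ι (τ g r) = τ₁ g (ι r))
    (hres : ∀ (g : I) (s : S), τ₁ g s - s ∈ maximalIdeal S)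
    {A₀ A₂ : Type*} [Group A₀] [Finite A₀] [Group A₂] [Finite A₂]
    (hA₀ : HasNormalSylow p A₀) (hA₂ : HasNormalSylow p A₂)
    (f₀ : I →* A₀) (hf₀ : ∀ g, f₀ g = 1 → ∀ r ∈ J,
      (∃ s ∈ maximalIdeal S, ι r = s * ι t) → τ g r - r ∈ maximalIdeal R ^ 2)
    (f₂ : I →* A₂) (hf₂ : ∀ g, f₂ g = 1 → ∀ r ∈ maximalIdeal R,
      τ g r - r ∈ J ⊔ maximalIdeal R ^ 2) :
    HasNormalSylow p I := by
  classical
  have hp : p.Prime := Fact.out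
  -- (0) `τ` is residue-trivial on `R` (`ι (τ g r - r) ∈ 𝔫`, `ι` local); `τ g - 1` preserves `𝔪²`
  have hresR : ∀ (g : I) (r : R), τ g r - r ∈ maximalIdeal R := fun g r => by
    have h : ι (τ g r - r) ∈ maximalIdeal S := by rw [map_sub, hcomp]; exact hres g (ι r)
    rw [mem_maximalIdeal, mem_nonunits_iff] at h ⊢
    exact fun hu => h (hu.map ι)
  have hp_mem : (p : R) ∈ maximalIdeal R := by
    rw [← residue_eq_zero_iff, map_natCast, CharP.cast_eq_zero]
  have hm2 : ∀ (g : I), ∀ x ∈ maximalIdeal R ^ 2, τ g x - x ∈ maximalIdeal R ^ 2 :=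
    fun g x hx => ringEquiv_apply_sub_mem_maximalIdeal_pow (τ g) 2 hx
  -- (1) the degenerate case `t = 0`: `J = 0` and `ker f₂` is already cotangent-trivial
  by_cases ht0 : t = 0
  · have hJ0 : ∀ j ∈ J, j = 0 := fun j hj => by
      have h : ι j ∈ Ideal.span {ι t} := hgen ▸ Ideal.mem_map_of_mem ι hj
      obtain ⟨a, ha⟩ := Ideal.mem_span_singleton'.mp h
      rw [ht0, map_zero, mul_zero] at ha
      exact hι (by rw [map_zero]; exact ha.symm)
    refine hasNormalSylow_of_pClosed_quotient p hτ hresR hA₂ f₂ 0 fun g hg r hr => ?_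
    obtain ⟨j, hj, m, hm, hjm⟩ := Submodule.mem_sup.mp (hf₂ g hg r hr)
    rw [pow_zero, pow_one, ← hjm, hJ0 j hj, zero_add]
    exact hm
  -- (2) `u := ι t ≠ 0`; `e r` with `ι r = e r * u` for `r ∈ J` (unique since `S` is a domain)
  set u : S := ι t
  have hu0 : u ≠ 0 := fun h => ht0 (hι (by rw [map_zero]; exact h))
  have hex : ∀ r : R, ∃ a : S, r ∈ J → a * u = ι r := fun r => by
    by_cases hr : r ∈ J
    · obtain ⟨a, ha⟩ := Ideal.mem_span_singleton'.mp
        (show ι r ∈ Ideal.span {u} from hgen ▸ Ideal.mem_map_of_mem ι hr)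
      exact ⟨a, fun _ => ha⟩
    · exact ⟨0, fun h => absurd h hr⟩
  choose e he using hex
  have he_uniq : ∀ r ∈ J, ∀ a : S, a * u = ι r → e r = a := fun r hr a ha =>
    mul_right_cancel₀ hu0 ((he r hr).trans ha.symm)
  have he_t : e t = 1 := he_uniq t ht 1 (one_mul u)
  have he_sub : ∀ r ∈ J, ∀ r' ∈ J, e (r - r') = e r - e r' :=
    fun r hr r' hr' => he_uniq _ (sub_mem hr hr') _ (by rw [sub_mul, he r hr, he r' hr', map_sub])
  -- `c g := e (τ g t)`: `τ₁ g u = c g * u`, a unit; the character `χ g := c g mod 𝔫`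
  have hres' : ∀ (g : I) (s : S), residue S (τ₁ g s) = residue S s := fun g s => by
    rw [← sub_eq_zero, ← map_sub, residue_eq_zero_iff]; exact hres g s
  have hτt : ∀ g : I, τ g t ∈ J := fun g => hJτ g t ht
  obtain ⟨c, hc⟩ : ∃ c : I → S, ∀ g, c g = e (τ g t) := ⟨_, fun _ => rfl⟩
  have hcu : ∀ g, c g * u = τ₁ g u := fun g => by rw [hc, he _ (hτt g), hcomp]
  have he_τ : ∀ (g : I), ∀ r ∈ J, e (τ g r) = τ₁ g (e r) * c g := fun g r hr =>
    he_uniq _ (hJτ g r hr) _ (by rw [mul_assoc, hcu, ← map_mul, he r hr, hcomp])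
  have hc_mul : ∀ g h : I, c (g * h) = τ₁ g (c h) * c g := fun g h => by
    rw [hc (g * h), map_mul, RingAut.mul_apply, he_τ g _ (hτt h), ← hc h]
  have hc_one : c 1 = 1 := by rw [hc, map_one, RingAut.one_apply, he_t]
  have hc_res : ∀ g, residue S (c g) ≠ 0 := fun g => (residue_ne_zero_iff_isUnit _).mpr
    (IsUnit.of_mul_eq_one_right (τ₁ g (c g⁻¹)) (by rw [← hc_mul, mul_inv_cancel, hc_one]))
  obtain ⟨χ, hχ⟩ : ∃ χ : I →* (ResidueField S)ˣ, ∀ g, (χ g : ResidueField S) = residue S (c g) :=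
    ⟨{ toFun := fun g => Units.mk0 (residue S (c g)) (hc_res g)
       map_one' := Units.ext (by simp only [Units.val_mk0, hc_one, map_one, Units.val_one])
       map_mul' := fun g h => Units.ext (by
         simp only [Units.val_mk0, Units.val_mul, hc_mul, map_mul, hres']
         rw [mul_comm]) }, fun g => rfl⟩
  -- (3) `W̃ := J ∩ ι⁻¹(𝔫 · u) = {r ∈ J | e r ∈ 𝔫}`; `(τ g - 1) J ⊆ W̃` on `ker χ`
  let W : Ideal R := J ⊓ Ideal.comap ι (maximalIdeal S * Ideal.span {u})
  have hWmem : ∀ r ∈ J, r ∈ W ↔ e r ∈ maximalIdeal S := fun r hr => by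
    constructor
    · rintro ⟨-, hr'⟩
      obtain ⟨s, hs, hsu⟩ := Ideal.mem_mul_span_singleton.mp (Ideal.mem_comap.mp hr')
      rw [he_uniq r hr s hsu]
      exact hs
    · intro her
      refine ⟨hr, Ideal.mem_comap.mpr (Ideal.mem_mul_span_singleton.mpr ⟨e r, her, he r hr⟩)⟩
  have hW_χ : ∀ g : I, χ g = 1 → ∀ r ∈ J, τ g r - r ∈ W := by
    intro g hg r hr
    refine (hWmem _ (sub_mem (hJτ g r hr) hr)).mpr ?_
    rw [← residue_eq_zero_iff, he_sub _ (hJτ g r hr) _ hr, he_τ g r hr, map_sub, map_mul, hres',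
      show residue S (c g) = 1 by rw [← hχ, hg, Units.val_one], mul_one, sub_self]
  have hW_f₀ : ∀ g : I, f₀ g = 1 → ∀ r ∈ W, τ g r - r ∈ maximalIdeal R ^ 2 := by
    intro g hg r hr
    have hrJ : r ∈ J := hr.1
    exact hf₀ g hg r hrJ ⟨e r, (hWmem r hrJ).mp hr, (he r hrJ).symm⟩
  -- (4) the flag `K = (𝔪², W̃ + 𝔪², J + 𝔪², 𝔪, 𝔪, …)` is lowered one step by `ker (f₀, χ, f₂)`
  let K : ℕ → Ideal R := fun i =>
    if i = 0 then maximalIdeal R ^ 2 else if i = 1 then W ⊔ maximalIdeal R ^ 2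
      else if i = 2 then J ⊔ maximalIdeal R ^ 2 else maximalIdeal R
  have hK0 : K 0 = maximalIdeal R ^ 2 := rfl
  have hK1 : K 1 = W ⊔ maximalIdeal R ^ 2 := rfl
  have hK2 : K 2 = J ⊔ maximalIdeal R ^ 2 := rfl
  have hK3 : K 3 = maximalIdeal R := rfl
  -- the p-closed target `A₀ × χ(I) × A₂`
  haveI : Finite χ.range := Finite.of_surjective _ χ.rangeRestrict_surjective
  have hχr : HasNormalSylow p χ.range := hasNormalSylow_range_of_comm χ
  have h3le : 3 ≤ p ^ 2 := by
    have h22 : 2 ^ 2 ≤ p ^ 2 := Nat.pow_le_pow_left hp.two_le 2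
    omega
  refine hasNormalSylow_of_pClosed_quotient p hτ hresR ((hA₀.prod hχr).prod hA₂)
    ((f₀.prod χ.rangeRestrict).prod f₂) 2 fun g hg => ?_
  rw [MonoidHom.prod_apply, MonoidHom.prod_apply, Prod.mk_eq_one, Prod.mk_eq_one] at hg
  obtain ⟨⟨hg₀, hgχ⟩, hg₂⟩ := hg
  have hgχ' : χ g = 1 := by
    have h := congrArg Subtype.val hgχ
    rwa [MonoidHom.coe_rangeRestrict, OneMemClass.coe_one] at h
  have hstep : ∀ i < 3, ∀ r ∈ K (i + 1), τ g r - r ∈ K i := by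
    intro i hi r hr
    interval_cases i
    · -- `W̃ + 𝔪² → 𝔪²`
      rw [zero_add, hK1] at hr
      rw [hK0]
      obtain ⟨w, hw, m, hm, rfl⟩ := Submodule.mem_sup.mp hr
      have key : τ g (w + m) - (w + m) = (τ g w - w) + (τ g m - m) := by rw [map_add]; ring
      rw [key]
      exact add_mem (hW_f₀ g hg₀ w hw) (hm2 g m hm)
    · -- `J + 𝔪² → W̃ + 𝔪²`
      rw [show (1 : ℕ) + 1 = 2 from rfl, hK2] at hr
      rw [hK1]
      obtain ⟨j, hj, m, hm, rfl⟩ := Submodule.mem_sup.mp hr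
      have key : τ g (j + m) - (j + m) = (τ g j - j) + (τ g m - m) := by rw [map_add]; ring
      rw [key]
      exact add_mem (Submodule.mem_sup_left (hW_χ g hgχ' j hj))
        (Submodule.mem_sup_right (hm2 g m hm))
    · -- `𝔪 → J + 𝔪²`
      rw [show (2 : ℕ) + 1 = 3 from rfl, hK3] at hr
      rw [hK2]
      exact hf₂ g hg₂ r hr
  rw [map_pow]
  exact cotangentTrivial_pow_of_iterate_sub p (τ g) (hresR g) hp_mem h3le fun r hr =>
    (hK0 ▸ iterate_sub_mem_of_flag (τ g) 3 K hstep 3 0 (le_refl 3) r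
      (by rw [zero_add, hK3]; exact hr) : _)

end Summit.ResolutionOfSingularities.ResolutionOfSingularities.Theorems.WildQuotientResolution.FlagStep
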